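import Mathlib
import HarnessLib
import Literature.RepresentationTheory.CompactGroups.WeylIntegralFormula
import Literature.LinearAlgebra.Matrix.NormalMatrixSpectralTheorem
import Literature.MathematicalPhysics.QuantumLattice.GaugeGroups
import Summits.Ventures.LatticeQCDFlow.Exactness.SubgroupProductHaar
import Summits.Ventures.LatticeQCDFlow.Exactness.KernelJacobianChart
import Summits.Ventures.LatticeQCDFlow.Exactness.KernelCouplingJacobian
import Summits.Ventures.LatticeQCDFlow.Exactness.SpectralKernelJacobianWeylShapeSU

/-!
# The spectral recipe with a MEASURABLE eigenvalue map: kernel, update and coupling layer on `SU(N)` are exact for Haar with no continuity hypothesis at all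

HONEST FRAMING: exact (Metropolis-corrected) sampling algorithms for lattice gauge theory;
figures of merit are autocorrelation/cost numbers at stated couplings and volumes; no
continuum-physics claim.

Venture `LatticeQCDFlow` (cell pub-lqcd), topic `Exactness`; FANOUT row 10 (`eng-equiv`, engine
`latflow.equiv` `spectral.spectral_kernel` / `spectral_coupling_layer`).  NEW WORK of the cell.  Every
spectral exactness theorem of this topic so far asks the eigenvalue map `f` to be CONTINUOUS on the whole
unimodular torus (jointly with the frozen context) and the density `j` to be continuous — only to obtain
MEASURABILITY of the kernel `h` (`h W = V·diag(f d)·V⋆`), of the layer update and of `j`.  The engine's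
`f` (a box flow in canonical-cell coordinates) and its booked density are discontinuous across the walls
of the alcove (a Haar-null set).  Here measurability is obtained DIRECTLY from descriptive set theory:
a function of `(y, W)` which, in every diagonalization `W = V·diag d·V⋆` with `V ∈ SU(N)`, equals a
jointly measurable expression `JD y V d` is jointly Borel — its sub-level sets and their complements are
images of Borel subsets of the Polish space `Y × SU(N) × SU(N)` under the continuous
`(y, V, T) ↦ (y, V T V⁻¹)` (Suslin, Mathlib `AnalyticSet.measurableSet_of_compl`).  Consequences: the
kernel, the layer update and the density are measurable as soon as `f` and the spectral datum `jD` are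
jointly MEASURABLE, and the kernel / coupling-layer exactness theorems hold with these hypotheses only
(Weyl's formula being the tree's theorem `weylIntegralFormula_specialUnitary_holds`, unconditionally).
Nothing is cited as a fact; no number; no definition.

## What is typed (`Y` Polish with its Borel σ-algebra — e.g. the frozen context `{i // ¬p i} → SU(N)`)

* `preimage_eq_image_conj_of_diagonalization`, **`measurable_of_diagonalization_jointly`** — the Suslin
  lemma with a datum `JD y V d` allowed to depend on the conjugator `V ∈ SU(N)`;
* `conj_diagonal_apply` — `(V·diag e·V⋆)_{ij} = Σ_k V_{ik} e_k conj(V_{jk})`;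
* **`measurable_spectralKernel_jointly`** — `f` jointly measurable, `h y` following the spectral recipe
  of `f y` ⇒ `(y, W) ↦ h y W` measurable; `measurable_spectralKernel_of_measurable` (no parameter);
* `measurable_spectralKernelUpdate_of_measurable` — the layer update `(u, y) ↦ h y (u S y)(u S y)⁻¹ u`;
* **`hasJacobian_spectralKernel_specialUnitaryGroup_of_measurable`** — single link: `f` measurable,
  `h` by the recipe, torus map `fT` with `HasJacobian (Haar SΔ) fT Jf`, `J` measurable with Boyda's
  identity ⇒ `HasJacobian (Haar SU(N)) h J`;
* **`hasJacobian_spectralCouplingLayer_specialUnitary_of_measurable`** — the layer: staples continuous,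
  `f a` jointly measurable, `j a` with a jointly measurable spectral datum `jD a`, nothing continuous.
-/

noncomputable section

namespace Summit.Ventures.LatticeQCDFlow.Exactness

open MeasureTheory Matrix Set Topology
open Literature.LinearAlgebra.Matrix
open Literature.MathematicalPhysics.QuantumFieldTheory
open Literature.RepresentationTheory.CompactGroups
open scoped ENNReal

variable {n : Type} [Fintype n] [DecidableEq n]

/-! ## The Suslin lemma with a conjugator-dependent datum -/

section Jointly

variable {Y : Type*} [TopologicalSpace Y] [PolishSpace Y] [MeasurableSpace Y] [BorelSpace Y]

omit [TopologicalSpace Y] [PolishSpace Y] [MeasurableSpace Y] [BorelSpace Y] in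
/-- **Preimages as continuous images.**  If `J y W = JD y V d` whenever `W = V·diag d·V⋆` with
`V ∈ SU(N)`, then `{(y, W) : J y W ∈ B}` is the image of `{(y, V, T) : T diagonal, JD y V (diag T) ∈ B}`
under `(y, V, T) ↦ (y, V T V⁻¹)`. -/
theorem preimage_eq_image_conj_of_diagonalization {β : Type*}
    {JD : Y → Matrix.specialUnitaryGroup n ℂ → (n → ℂ) → β} {J : Y → Matrix.specialUnitaryGroup n ℂ → β}
    (hJspec : ∀ (y : Y) (W V : Matrix.specialUnitaryGroup n ℂ) (d : n → ℂ),
      (W : Matrix n n ℂ) = (V : Matrix n n ℂ) * diagonal d * star (V : Matrix n n ℂ) → J y W = JD y V d)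
    (B : Set β) :
    (fun q : Y × Matrix.specialUnitaryGroup n ℂ => J q.1 q.2) ⁻¹' B =
      (fun q : Y × (Matrix.specialUnitaryGroup n ℂ × Matrix.specialUnitaryGroup n ℂ) =>
          (q.1, q.2.1 * q.2.2 * q.2.1⁻¹)) ''
        {q | (∀ i j, i ≠ j → ((q.2.2 : Matrix.specialUnitaryGroup n ℂ) : Matrix n n ℂ) i j = 0) ∧
          JD q.1 q.2.1 (fun i => ((q.2.2 : Matrix.specialUnitaryGroup n ℂ) : Matrix n n ℂ) i i) ∈ B} := by
  ext ⟨y, W⟩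
  constructor
  · intro hW
    have hWu : (W : Matrix n n ℂ) ∈ Matrix.unitaryGroup n ℂ := (Matrix.mem_specialUnitaryGroup_iff.mp W.2).1
    have hWn : IsStarNormal (W : Matrix n n ℂ) :=
      ⟨by rw [Commute, SemiconjBy, Matrix.mem_unitaryGroup_iff'.mp hWu, Matrix.mem_unitaryGroup_iff.mp hWu]⟩
    obtain ⟨V, hV, d, hd⟩ :=
      Literature.LinearAlgebra.Matrix.exists_specialUnitaryGroup_forall_conj_eq_diagonal_of_commute_of_isStarNormal
        (fun _ : Unit => (W : Matrix n n ℂ)) (fun _ => hWn) (fun _ _ => Commute.refl _)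
    set V' : Matrix.specialUnitaryGroup n ℂ := ⟨V, hV⟩ with hV'
    set T : Matrix.specialUnitaryGroup n ℂ := V'⁻¹ * W * V' with hTdef
    have hT : (T : Matrix n n ℂ) = diagonal (d ()) := hd ()
    have h2 : V * star V = 1 := Matrix.mem_unitaryGroup_iff.mp (Matrix.mem_specialUnitaryGroup_iff.mp hV).1
    have hWd : (W : Matrix n n ℂ) = (V' : Matrix n n ℂ) * diagonal (fun i => (T : Matrix n n ℂ) i i) * star (V' : Matrix n n ℂ) := by
      have hdiag : (fun i => (T : Matrix n n ℂ) i i) = d () := funext fun i => by rw [hT, diagonal_apply_eq]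
      rw [hdiag]
      show (W : Matrix n n ℂ) = V * diagonal (d ()) * star V
      calc (W : Matrix n n ℂ) = (V * star V) * (W : Matrix n n ℂ) * (V * star V) := by
            rw [h2, Matrix.one_mul, Matrix.mul_one]
        _ = V * (star V * (W : Matrix n n ℂ) * V) * star V := by simp only [Matrix.mul_assoc]
        _ = V * diagonal (d ()) * star V := by rw [hd ()]
    refine ⟨(y, (V', T)), ⟨fun i j hij => by rw [hT, diagonal_apply_ne _ hij], ?_⟩, ?_⟩
    · show JD y V' (fun i => (T : Matrix n n ℂ) i i) ∈ B
      rw [← hJspec y W V' _ hWd]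
      exact hW
    · show (y, V' * T * V'⁻¹) = (y, W)
      rw [hTdef]
      congr 1
      group
  · rintro ⟨⟨y', V, T⟩, ⟨hT, hB⟩, hq⟩
    simp only [Prod.mk.injEq] at hq
    obtain ⟨rfl, rfl⟩ := hq
    show J y' (V * T * V⁻¹) ∈ B
    have hTd : (T : Matrix n n ℂ) = diagonal fun i => (T : Matrix n n ℂ) i i := by
      ext i j
      by_cases hij : i = j
      · subst hij
        rw [diagonal_apply_eq]
      · rw [diagonal_apply_ne _ hij, hT i j hij]
    have hcoe : (((V * T * V⁻¹ : Matrix.specialUnitaryGroup n ℂ)) : Matrix n n ℂ) =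
        (V : Matrix n n ℂ) * diagonal (fun i => (T : Matrix n n ℂ) i i) * star (V : Matrix n n ℂ) := by
      rw [← hTd]
      rfl
    rw [hJspec _ _ _ _ hcoe]
    exact hB

/-- **Joint measurability from a measurable diagonalization datum (Suslin).**  `Y` Polish;
`J y W = JD y V d` whenever `W = V·diag d·V⋆`, `V ∈ SU(N)`; `(y, V, T) ↦ JD y V (diag T)` measurable on
`Y × SU(N) × SU(N)` ⇒ `(y, W) ↦ J y W` measurable. -/
theorem measurable_of_diagonalization_jointly {β : Type*} [MeasurableSpace β]
    {JD : Y → Matrix.specialUnitaryGroup n ℂ → (n → ℂ) → β}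
    (hJDm : Measurable fun q : Y × (Matrix.specialUnitaryGroup n ℂ × Matrix.specialUnitaryGroup n ℂ) =>
      JD q.1 q.2.1 (fun i => ((q.2.2 : Matrix.specialUnitaryGroup n ℂ) : Matrix n n ℂ) i i))
    {J : Y → Matrix.specialUnitaryGroup n ℂ → β}
    (hJspec : ∀ (y : Y) (W V : Matrix.specialUnitaryGroup n ℂ) (d : n → ℂ),
      (W : Matrix n n ℂ) = (V : Matrix n n ℂ) * diagonal d * star (V : Matrix n n ℂ) → J y W = JD y V d) :
    Measurable fun q : Y × Matrix.specialUnitaryGroup n ℂ => J q.1 q.2 := by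
  haveI : SecondCountableTopology (Matrix n n ℂ) := inferInstanceAs (SecondCountableTopology (n → n → ℂ))
  haveI : SecondCountableTopology (Matrix.specialUnitaryGroup n ℂ) :=
    Topology.IsEmbedding.subtypeVal.secondCountableTopology
  intro B hB
  have hΨ : Continuous fun q : Y × (Matrix.specialUnitaryGroup n ℂ × Matrix.specialUnitaryGroup n ℂ) =>
      (q.1, q.2.1 * q.2.2 * q.2.1⁻¹) :=
    continuous_fst.prodMk (((continuous_fst.comp continuous_snd).mul (continuous_snd.comp continuous_snd)).mul
      (continuous_fst.comp continuous_snd).inv)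
  have hentry : ∀ i j, Continuous
      fun q : Y × (Matrix.specialUnitaryGroup n ℂ × Matrix.specialUnitaryGroup n ℂ) =>
        ((q.2.2 : Matrix.specialUnitaryGroup n ℂ) : Matrix n n ℂ) i j := fun i j => by
    have h1 : Continuous fun q : Y × (Matrix.specialUnitaryGroup n ℂ × Matrix.specialUnitaryGroup n ℂ) =>
        ((q.2.2 : Matrix.specialUnitaryGroup n ℂ) : Matrix n n ℂ) :=
      continuous_subtype_val.comp (continuous_snd.comp continuous_snd)
    exact (continuous_apply j).comp ((continuous_apply i).comp h1)
  have hS : ∀ C : Set β, MeasurableSet C → MeasurableSet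
      {q : Y × (Matrix.specialUnitaryGroup n ℂ × Matrix.specialUnitaryGroup n ℂ) |
        (∀ i j, i ≠ j → ((q.2.2 : Matrix.specialUnitaryGroup n ℂ) : Matrix n n ℂ) i j = 0) ∧
          JD q.1 q.2.1 (fun i => ((q.2.2 : Matrix.specialUnitaryGroup n ℂ) : Matrix n n ℂ) i i) ∈ C} := by
    intro C hC
    have hdiag : MeasurableSet {q : Y × (Matrix.specialUnitaryGroup n ℂ × Matrix.specialUnitaryGroup n ℂ) |
        ∀ i j, i ≠ j → ((q.2.2 : Matrix.specialUnitaryGroup n ℂ) : Matrix n n ℂ) i j = 0} := by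
      have hset : {q : Y × (Matrix.specialUnitaryGroup n ℂ × Matrix.specialUnitaryGroup n ℂ) |
          ∀ i j, i ≠ j → ((q.2.2 : Matrix.specialUnitaryGroup n ℂ) : Matrix n n ℂ) i j = 0} =
          ⋂ i, ⋂ j, {q | i ≠ j → ((q.2.2 : Matrix.specialUnitaryGroup n ℂ) : Matrix n n ℂ) i j = 0} := by
        ext q
        simp only [mem_setOf_eq, mem_iInter]
      rw [hset]
      refine MeasurableSet.iInter fun i => MeasurableSet.iInter fun j => ?_
      by_cases hij : i = j
      · have h0 : {q : Y × (Matrix.specialUnitaryGroup n ℂ × Matrix.specialUnitaryGroup n ℂ) |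
            i ≠ j → ((q.2.2 : Matrix.specialUnitaryGroup n ℂ) : Matrix n n ℂ) i j = 0} = univ := by
          ext q
          simp [hij]
        rw [h0]
        exact MeasurableSet.univ
      · have h0 : {q : Y × (Matrix.specialUnitaryGroup n ℂ × Matrix.specialUnitaryGroup n ℂ) |
            i ≠ j → ((q.2.2 : Matrix.specialUnitaryGroup n ℂ) : Matrix n n ℂ) i j = 0} =
            {q | ((q.2.2 : Matrix.specialUnitaryGroup n ℂ) : Matrix n n ℂ) i j = 0} := by
          ext q
          simp [hij]
        rw [h0]
        exact (isClosed_eq (hentry i j) continuous_const).measurableSet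
    rw [setOf_and]
    exact hdiag.inter (hJDm hC)
  have hA : ∀ C : Set β, MeasurableSet C →
      AnalyticSet ((fun q : Y × Matrix.specialUnitaryGroup n ℂ => J q.1 q.2) ⁻¹' C) := fun C hC => by
    rw [preimage_eq_image_conj_of_diagonalization hJspec C]
    exact (hS C hC).analyticSet_image hΨ.measurable
  exact (hA B hB).measurableSet_of_compl (by rw [← preimage_compl]; exact hA Bᶜ hB.compl)

omit [DecidableEq n] in
/-- Entries of a conjugated diagonal matrix: `(V·diag e·V⋆)_{ij} = Σ_k V_{ik} e_k (V⋆)_{kj}`. -/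
theorem conj_diagonal_apply [DecidableEq n] (V : Matrix n n ℂ) (e : n → ℂ) (i j : n) :
    (V * diagonal e * star V) i j = ∑ k, V i k * e k * star (V j k) := by
  rw [Matrix.mul_apply]
  refine Finset.sum_congr rfl fun k _ => ?_
  rw [Matrix.mul_diagonal, Matrix.star_apply]

/-- **The spectral kernel is jointly measurable for a jointly MEASURABLE eigenvalue map.**  `f` with
`(y, d) ↦ f y d` measurable; `h y` following the spectral recipe of `f y` (`h y P = V·diag(f y d)·V⋆`
whenever `P = V·diag d·V⋆`, `V` unitary).  Then `(y, W) ↦ h y W` is measurable.  No continuity. -/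
theorem measurable_spectralKernel_jointly {f : Y → (n → ℂ) → (n → ℂ)}
    (hfm : Measurable fun q : Y × (n → ℂ) => f q.1 q.2)
    {h : Y → Matrix.specialUnitaryGroup n ℂ → Matrix.specialUnitaryGroup n ℂ}
    (hagree : ∀ (y : Y) (P : Matrix.specialUnitaryGroup n ℂ) (V : Matrix n n ℂ) (d : n → ℂ),
      V ∈ Matrix.unitaryGroup n ℂ → (P : Matrix n n ℂ) = V * diagonal d * star V →
        ((h y P : Matrix.specialUnitaryGroup n ℂ) : Matrix n n ℂ) = V * diagonal (f y d) * star V) :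
    Measurable fun q : Y × Matrix.specialUnitaryGroup n ℂ => h q.1 q.2 := by
  haveI : SecondCountableTopology (Matrix n n ℂ) := inferInstanceAs (SecondCountableTopology (n → n → ℂ))
  haveI : SecondCountableTopology (Matrix.specialUnitaryGroup n ℂ) :=
    Topology.IsEmbedding.subtypeVal.secondCountableTopology
  letI : MeasurableSpace (Matrix n n ℂ) := inferInstanceAs (MeasurableSpace (n → n → ℂ))
  haveI : BorelSpace (Matrix n n ℂ) := inferInstanceAs (BorelSpace (n → n → ℂ))
  -- the matrix of `h y W` is a jointly measurable function of `(y, W)` (Suslin)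
  have hentry : ∀ i j, Measurable
      fun q : Y × (Matrix.specialUnitaryGroup n ℂ × Matrix.specialUnitaryGroup n ℂ) =>
        ((q.2.1 : Matrix.specialUnitaryGroup n ℂ) : Matrix n n ℂ) i j := fun i j => by
    have h1 : Continuous fun q : Y × (Matrix.specialUnitaryGroup n ℂ × Matrix.specialUnitaryGroup n ℂ) =>
        ((q.2.1 : Matrix.specialUnitaryGroup n ℂ) : Matrix n n ℂ) :=
      continuous_subtype_val.comp (continuous_fst.comp continuous_snd)
    exact ((continuous_apply j).comp ((continuous_apply i).comp h1)).measurable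
  have hdiagT : Measurable fun q : Y × (Matrix.specialUnitaryGroup n ℂ × Matrix.specialUnitaryGroup n ℂ) =>
      fun i => ((q.2.2 : Matrix.specialUnitaryGroup n ℂ) : Matrix n n ℂ) i i := by
    refine measurable_pi_lambda _ fun i => ?_
    have h1 : Continuous fun q : Y × (Matrix.specialUnitaryGroup n ℂ × Matrix.specialUnitaryGroup n ℂ) =>
        ((q.2.2 : Matrix.specialUnitaryGroup n ℂ) : Matrix n n ℂ) :=
      continuous_subtype_val.comp (continuous_snd.comp continuous_snd)
    exact ((continuous_apply i).comp ((continuous_apply i).comp h1)).measurable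
  have hfq : ∀ k, Measurable fun q : Y × (Matrix.specialUnitaryGroup n ℂ × Matrix.specialUnitaryGroup n ℂ) =>
      f q.1 (fun i => ((q.2.2 : Matrix.specialUnitaryGroup n ℂ) : Matrix n n ℂ) i i) k := fun k =>
    (measurable_pi_apply k).comp (hfm.comp (measurable_fst.prodMk hdiagT))
  have key : Measurable fun q : Y × Matrix.specialUnitaryGroup n ℂ =>
      ((h q.1 q.2 : Matrix.specialUnitaryGroup n ℂ) : Matrix n n ℂ) := by
    refine measurable_of_diagonalization_jointly (β := Matrix n n ℂ)
      (J := fun y W => ((h y W : Matrix.specialUnitaryGroup n ℂ) : Matrix n n ℂ))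
      (JD := fun y V d => (V : Matrix n n ℂ) * diagonal (f y d) * star (V : Matrix n n ℂ)) ?_ ?_
    · refine measurable_pi_lambda _ fun i => measurable_pi_lambda _ fun j => ?_
      simp only [conj_diagonal_apply]
      exact Finset.measurable_sum _ fun k _ => ((hentry i k).mul (hfq k)).mul
        (continuous_star.measurable.comp (hentry j k))
    · intro y W V d hW
      exact hagree y W V d (Matrix.mem_specialUnitaryGroup_iff.mp V.2).1 hW
  -- `SU(N) ↪ Matrix` is a measurable embedding for the Borel structures, so this suffices
  have hσ : (Subtype.instMeasurableSpace : MeasurableSpace (Matrix.specialUnitaryGroup n ℂ)) =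
      Matrix.specialUnitaryGroup.instMeasurableSpace :=
    @BorelSpace.measurable_eq _ _ Subtype.instMeasurableSpace (Subtype.borelSpace _)
  have hemb : MeasurableEmbedding (Subtype.val : Matrix.specialUnitaryGroup n ℂ → Matrix n n ℂ) := by
    have h0 := (IsClosed.isClosedEmbedding_subtypeVal (isCompact_iff_compactSpace.mpr
      (inferInstance : CompactSpace (Matrix.specialUnitaryGroup n ℂ))).isClosed).measurableEmbedding
    rwa [hσ] at h0
  exact hemb.measurable_comp_iff.mp key

end Jointly

/-! ## Consequences on `SU(N)`: kernel, update, layer -/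

/-- **The spectral kernel of a measurable eigenvalue map is measurable** (no parameter). -/
theorem measurable_spectralKernel_of_measurable {f : (n → ℂ) → (n → ℂ)} (hfm : Measurable f)
    {h : Matrix.specialUnitaryGroup n ℂ → Matrix.specialUnitaryGroup n ℂ}
    (hagree : ∀ (P : Matrix.specialUnitaryGroup n ℂ) (V : Matrix n n ℂ) (d : n → ℂ),
      V ∈ Matrix.unitaryGroup n ℂ → (P : Matrix n n ℂ) = V * diagonal d * star V →
        ((h P : Matrix.specialUnitaryGroup n ℂ) : Matrix n n ℂ) = V * diagonal (f d) * star V) :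
    Measurable h :=
  (measurable_spectralKernel_jointly (Y := Matrix.specialUnitaryGroup n ℂ) (f := fun _ d => f d)
    (hfm.comp measurable_snd) (h := fun _ P => h P) (fun _ => hagree)).comp (measurable_const.prodMk measurable_id
      (f := fun _ : Matrix.specialUnitaryGroup n ℂ => (1 : Matrix.specialUnitaryGroup n ℂ)))

/-- **The layer update `(u, y) ↦ h y (u·S y)·(u·S y)⁻¹·u` is jointly measurable** for a jointly
measurable eigenvalue map, kernels by the recipe, and a measurable staple `S`. -/
theorem measurable_spectralKernelUpdate_of_measurable {Y : Type*} [TopologicalSpace Y] [PolishSpace Y]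
    [MeasurableSpace Y] [BorelSpace Y] {f : Y → (n → ℂ) → (n → ℂ)}
    (hfm : Measurable fun q : Y × (n → ℂ) => f q.1 q.2)
    {h : Y → Matrix.specialUnitaryGroup n ℂ → Matrix.specialUnitaryGroup n ℂ}
    (hagree : ∀ (y : Y) (P : Matrix.specialUnitaryGroup n ℂ) (V : Matrix n n ℂ) (d : n → ℂ),
      V ∈ Matrix.unitaryGroup n ℂ → (P : Matrix n n ℂ) = V * diagonal d * star V →
        ((h y P : Matrix.specialUnitaryGroup n ℂ) : Matrix n n ℂ) = V * diagonal (f y d) * star V)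
    {S : Y → Matrix.specialUnitaryGroup n ℂ} (hS : Measurable S) :
    Measurable fun q : Matrix.specialUnitaryGroup n ℂ × Y =>
      h q.2 (q.1 * S q.2) * (q.1 * S q.2)⁻¹ * q.1 := by
  haveI : SecondCountableTopology (Matrix n n ℂ) := inferInstanceAs (SecondCountableTopology (n → n → ℂ))
  haveI : SecondCountableTopology (Matrix.specialUnitaryGroup n ℂ) :=
    Topology.IsEmbedding.subtypeVal.secondCountableTopology
  have hloop : Measurable fun q : Matrix.specialUnitaryGroup n ℂ × Y => q.1 * S q.2 :=
    measurable_fst.mul (hS.comp measurable_snd)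
  exact (((measurable_spectralKernel_jointly hfm hagree).comp (measurable_snd.prodMk hloop)).mul hloop.inv).mul
    measurable_fst

/-- **Single link: the `SU(N)` spectral kernel of a MEASURABLE eigenvalue map is an exact transport
of Haar.**  `f` measurable; `h` by the spectral recipe of `f`; torus map `fT` (`diag d ↦ diag(f d)`)
with `HasJacobian (Haar SΔ(N)) fT Jf`; `J` measurable with Boyda's identity
`J(g t g⁻¹)·|Δ(t)|²/N! = Jf(t)·|Δ(fT t)|²/N!`.  Then `HasJacobian (Haar SU(N)) h J` — unconditionally
(Weyl's formula is the tree's theorem). -/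
theorem hasJacobian_spectralKernel_specialUnitaryGroup_of_measurable
    {f : (n → ℂ) → (n → ℂ)} (hfm : Measurable f)
    {h : Matrix.specialUnitaryGroup n ℂ → Matrix.specialUnitaryGroup n ℂ}
    (hagree : ∀ (P : Matrix.specialUnitaryGroup n ℂ) (V : Matrix n n ℂ) (d : n → ℂ),
      V ∈ Matrix.unitaryGroup n ℂ → (P : Matrix n n ℂ) = V * diagonal d * star V →
        ((h P : Matrix.specialUnitaryGroup n ℂ) : Matrix n n ℂ) = V * diagonal (f d) * star V)
    {fT : specialDiagonalTorus n → specialDiagonalTorus n}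
    (hfT : ∀ t : specialDiagonalTorus n, ((fT t : Matrix.specialUnitaryGroup n ℂ) : Matrix n n ℂ) =
      diagonal (f fun i => ((t : Matrix.specialUnitaryGroup n ℂ) : Matrix n n ℂ) i i))
    {Jf : specialDiagonalTorus n → ℝ≥0∞} (hfJ : HasJacobian (haarProbability (specialDiagonalTorus n)) fT Jf)
    {J : Matrix.specialUnitaryGroup n ℂ → ℝ≥0∞} (hJm : Measurable J)
    (hJ : ∀ (g : Matrix.specialUnitaryGroup n ℂ) (t : specialDiagonalTorus n),
      J (g * (t : Matrix.specialUnitaryGroup n ℂ) * g⁻¹) * ENNReal.ofReal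
          ((∏ i, ∏ j ∈ Finset.univ.erase i,
            ‖((t : Matrix.specialUnitaryGroup n ℂ) : Matrix n n ℂ) i i -
              ((t : Matrix.specialUnitaryGroup n ℂ) : Matrix n n ℂ) j j‖) / (Fintype.card n).factorial) =
        Jf t * ENNReal.ofReal
          ((∏ i, ∏ j ∈ Finset.univ.erase i,
            ‖((fT t : Matrix.specialUnitaryGroup n ℂ) : Matrix n n ℂ) i i -
              ((fT t : Matrix.specialUnitaryGroup n ℂ) : Matrix n n ℂ) j j‖) / (Fintype.card n).factorial)) :
    HasJacobian (haarProbability (Matrix.specialUnitaryGroup n ℂ)) h J :=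
  hasJacobian_of_chart measurable_conjChart_special measurable_vandermondeWeight_special
    (weylIntegralFormula_specialUnitary_holds n) hfJ (measurable_spectralKernel_of_measurable hfm hagree)
    (fun g t => spectralKernel_conj_specialDiagonalTorus hagree hfT g t) hJm (fun q => hJ q)

/-- **The `SU(N)` spectral coupling layer with MEASURABLE data.**  Staples `S a` continuous; eigenvalue
maps `f a` jointly measurable in (context, spectrum); kernels `h a y` by the spectral recipe; per-link
torus maps `fT a y` with torus Jacobians `JfT a y`; densities `j a y ≥ 0` with a jointly measurable
spectral datum `jD a` (`j a y W = jD a y d` whenever `W = V·diag d·V⋆`, `V` unitary) and Boyda's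
identity `hJ`.  Then the layer `Theory2.coupleFun p …` is an exact transport of `⊗ Haar` with Jacobian
`Theory2.coupleJac p (j at the loops)`.  Nothing is assumed continuous except the staples. -/
theorem hasJacobian_spectralCouplingLayer_specialUnitary_of_measurable {ι : Type*} [Fintype ι]
    (p : ι → Prop) [DecidablePred p]
    (S : {i // p i} → ({i // ¬p i} → Matrix.specialUnitaryGroup n ℂ) → Matrix.specialUnitaryGroup n ℂ)
    (hS : ∀ a, Continuous (S a))
    (f : {i // p i} → ({i // ¬p i} → Matrix.specialUnitaryGroup n ℂ) → (n → ℂ) → (n → ℂ))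
    (hfm : ∀ a, Measurable fun q : ({i // ¬p i} → Matrix.specialUnitaryGroup n ℂ) × (n → ℂ) => f a q.1 q.2)
    (h : {i // p i} → ({i // ¬p i} → Matrix.specialUnitaryGroup n ℂ) →
      Matrix.specialUnitaryGroup n ℂ → Matrix.specialUnitaryGroup n ℂ)
    (hagree : ∀ a y (P : Matrix.specialUnitaryGroup n ℂ) (V : Matrix n n ℂ) (d : n → ℂ),
      V ∈ Matrix.unitaryGroup n ℂ → (P : Matrix n n ℂ) = V * diagonal d * star V →
        ((h a y P : Matrix.specialUnitaryGroup n ℂ) : Matrix n n ℂ) = V * diagonal (f a y d) * star V)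
    (fT : {i // p i} → ({i // ¬p i} → Matrix.specialUnitaryGroup n ℂ) →
      specialDiagonalTorus n → specialDiagonalTorus n)
    (hfT : ∀ a y (t : specialDiagonalTorus n),
      ((fT a y t : Matrix.specialUnitaryGroup n ℂ) : Matrix n n ℂ) =
        diagonal (f a y fun i => ((t : Matrix.specialUnitaryGroup n ℂ) : Matrix n n ℂ) i i))
    (JfT : {i // p i} → ({i // ¬p i} → Matrix.specialUnitaryGroup n ℂ) → specialDiagonalTorus n → ℝ≥0∞)
    (hfJ : ∀ a y, HasJacobian (haarProbability (specialDiagonalTorus n)) (fT a y) (JfT a y))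
    (j : {i // p i} → ({i // ¬p i} → Matrix.specialUnitaryGroup n ℂ) → Matrix.specialUnitaryGroup n ℂ → ℝ)
    (hj0 : ∀ a y g, 0 ≤ j a y g)
    (jD : {i // p i} → ({i // ¬p i} → Matrix.specialUnitaryGroup n ℂ) → (n → ℂ) → ℝ)
    (hjDm : ∀ a, Measurable fun q : ({i // ¬p i} → Matrix.specialUnitaryGroup n ℂ) × (n → ℂ) => jD a q.1 q.2)
    (hjspec : ∀ a y (W : Matrix.specialUnitaryGroup n ℂ) (V : Matrix n n ℂ) (d : n → ℂ),
      V ∈ Matrix.unitaryGroup n ℂ → (W : Matrix n n ℂ) = V * diagonal d * star V → j a y W = jD a y d)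
    (hJ : ∀ a y (g : Matrix.specialUnitaryGroup n ℂ) (t : specialDiagonalTorus n),
      ENNReal.ofReal (j a y (g * (t : Matrix.specialUnitaryGroup n ℂ) * g⁻¹)) * ENNReal.ofReal
          ((∏ i, ∏ k ∈ Finset.univ.erase i,
            ‖((t : Matrix.specialUnitaryGroup n ℂ) : Matrix n n ℂ) i i -
              ((t : Matrix.specialUnitaryGroup n ℂ) : Matrix n n ℂ) k k‖) / (Fintype.card n).factorial) =
        JfT a y t * ENNReal.ofReal
          ((∏ i, ∏ k ∈ Finset.univ.erase i,
            ‖((fT a y t : Matrix.specialUnitaryGroup n ℂ) : Matrix n n ℂ) i i -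
              ((fT a y t : Matrix.specialUnitaryGroup n ℂ) : Matrix n n ℂ) k k‖) / (Fintype.card n).factorial)) :
    HasJacobian (Measure.pi fun _ : ι => haarProbability (Matrix.specialUnitaryGroup n ℂ))
      (Theory2.coupleFun p fun a y u => h a y (u * S a y) * (u * S a y)⁻¹ * u)
      fun U => ENNReal.ofReal (Theory2.coupleJac p (fun a y u => j a y (u * S a y)) U) := by
  haveI : SecondCountableTopology (Matrix n n ℂ) := inferInstanceAs (SecondCountableTopology (n → n → ℂ))
  haveI : SecondCountableTopology (Matrix.specialUnitaryGroup n ℂ) :=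
    Topology.IsEmbedding.subtypeVal.secondCountableTopology
  -- the density: a `V`-independent datum
  have hjm : ∀ a, Measurable fun q : ({i // ¬p i} → Matrix.specialUnitaryGroup n ℂ) × Matrix.specialUnitaryGroup n ℂ =>
      j a q.1 q.2 := by
    intro a
    have hdiagT : Measurable fun q : ({i // ¬p i} → Matrix.specialUnitaryGroup n ℂ) ×
        (Matrix.specialUnitaryGroup n ℂ × Matrix.specialUnitaryGroup n ℂ) =>
          fun i => ((q.2.2 : Matrix.specialUnitaryGroup n ℂ) : Matrix n n ℂ) i i := by
      refine measurable_pi_lambda _ fun i => ?_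
      have h1 : Continuous fun q : ({i // ¬p i} → Matrix.specialUnitaryGroup n ℂ) ×
          (Matrix.specialUnitaryGroup n ℂ × Matrix.specialUnitaryGroup n ℂ) =>
            ((q.2.2 : Matrix.specialUnitaryGroup n ℂ) : Matrix n n ℂ) :=
        continuous_subtype_val.comp (continuous_snd.comp continuous_snd)
      exact ((continuous_apply i).comp ((continuous_apply i).comp h1)).measurable
    exact measurable_of_diagonalization_jointly (JD := fun y _ d => jD a y d)
      ((hjDm a).comp (measurable_fst.prodMk hdiagT))
      (fun y W V d hW => hjspec a y W V d (Matrix.mem_specialUnitaryGroup_iff.mp V.2).1 hW)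
  have hjloop : ∀ a, Measurable fun q : Matrix.specialUnitaryGroup n ℂ × ({i // ¬p i} → Matrix.specialUnitaryGroup n ℂ) =>
      j a q.2 (q.1 * S a q.2) := fun a =>
    (hjm a).comp (measurable_snd.prodMk (measurable_fst.mul ((hS a).measurable.comp measurable_snd)))
  have hjslice : ∀ a y, Measurable fun g : Matrix.specialUnitaryGroup n ℂ => ENNReal.ofReal (j a y g) := fun a y =>
    ENNReal.measurable_ofReal.comp ((hjm a).comp (measurable_const.prodMk measurable_id))
  have hfslice : ∀ a y, Measurable (f a y) := fun a y => (hfm a).comp (measurable_const.prodMk measurable_id)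
  exact hasJacobian_kernelCouplingLayer p S h j
    (fun a => measurable_spectralKernelUpdate_of_measurable (hfm a) (hagree a) (hS a).measurable) hjloop
    (fun a y => hasJacobian_spectralKernel_specialUnitaryGroup_of_measurable (hfslice a y) (hagree a y) (hfT a y)
      (hfJ a y) (hjslice a y) (hJ a y))
    hj0

end Summit.Ventures.LatticeQCDFlow.Exactness
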